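import Mathlib
import HarnessLib

/-!
# EnskogAdjointDuality / AdjointEnskogTestFamilyR — stub `kernelCritical`, preparatory layer

Support lemmas for the stub `stub_kernelCritical` (criticality of the `ℓ = 0` sector, line
`refutation` of crux `Summit.AtomisticToContinuum.HydrodynamicLimit.Theses.EnskogAdjointDuality.AdjointEnskogTestFamilyR`,
stmt-AtomisticToContinuum-11592).  One-dimensional real analysis of the critical isotropic weight
`ϑ_R(E) = (1+E)⁻³ e^{-E/R}` (energy variable `E = |v|²`, cut-off scale `R > 0`) and of its tail
`Θ̄_R(x) = ∫_x^∞ ϑ_R`: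

* elementary inequalities (`(1+y)³ ≤ 384 e^{y/4}`, `(1+y)² ≤ 32 e^{y/4}`, `u(√(u²+3) - u) ≤ 3/2`);
* the primitive `-(1/2)(1+E)⁻² e^{-E/R}` of `ϑ_R + (2R)⁻¹ ψ_R`, `ψ_R(E) = (1+E)⁻² e^{-E/R}`, and the
  resulting closed form `Θ̄_R(x) = ½ ψ_R(x) - (2R)⁻¹ ∫_x^∞ ψ_R`;
* the CRITICAL IDENTITY `x ϑ_R(x) + ϑ_R(x) - 2 Θ̄_R(x) = R⁻¹ ∫_x^∞ ψ_R ∈ [0, R⁻¹ e^{-x/R} (1+x)⁻¹]`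
  (the exact cancellation of gain `2Θ̄/√E` against loss `√E ϑ` at the power `3`);
* `Θ̄_R` is `C¹` on `(-1, ∞)` with `Θ̄_R' = -ϑ_R`, and `0 ≤ Θ̄_R(x) ≤ ½ (1+x)⁻²` for `x ≥ 0`;
* at fixed energy `E ≥ 0`: the Gaussian-tail part of the sphere-reduced gain is `≤ e^{-E/2}`, and its
  positive-part part reduces to `√E ∫_0^1 Θ̄_R(E t²) t e^{-E(1-t²)/2} dt`.

The functions are passed as variables `ϑ Θ : ℝ → ℝ` pinned by defining equations (`hϑ`, `hΘ`), so
that the `let`-bound objects of the registered stub statement can be substituted by `rfl`.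
-/

noncomputable section

open MeasureTheory Set Filter Topology
open scoped Real Topology

namespace Summit.AtomisticToContinuum.HydrodynamicLimit.Theorems.EnskogAdjointDuality

/-! ## Elementary inequalities -/

/-- `(1+y)³ ≤ 384 e^{y/4}` for `y ≥ 0`. [folklore] -/
theorem k2r_ref_K0_cube_le_exp {y : ℝ} (hy : 0 ≤ y) : (1 + y) ^ 3 ≤ 384 * Real.exp (y / 4) := by
  have h := Real.sum_le_exp_of_nonneg (x := y / 4) (by positivity) 4
  simp only [Finset.sum_range_succ, Finset.sum_range_zero, Nat.factorial] at h
  norm_num at h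
  nlinarith [h, sq_nonneg y, mul_nonneg hy (sq_nonneg y)]

/-- `(1+y)² ≤ 32 e^{y/4}` for `y ≥ 0`. [folklore] -/
theorem k2r_ref_K0_sq_le_exp {y : ℝ} (hy : 0 ≤ y) : (1 + y) ^ 2 ≤ 32 * Real.exp (y / 4) := by
  have h := Real.quadratic_le_exp_of_nonneg (x := y / 4) (by positivity)
  nlinarith [h, sq_nonneg y]

/-- `u (√(u²+3) - u) ≤ 3/2`. [folklore] -/
theorem k2r_ref_K0_mul_sqrt_sub_le (u : ℝ) : u * (Real.sqrt (u ^ 2 + 3) - u) ≤ 3 / 2 := by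
  have hs := Real.sq_sqrt (show (0:ℝ) ≤ u ^ 2 + 3 by positivity)
  nlinarith [sq_nonneg (u - Real.sqrt (u ^ 2 + 3)), Real.sqrt_nonneg (u ^ 2 + 3)]

/-- `(1+E)² e^{-E/2} ≤ 32 e^{-E/4}` for `E ≥ 0`. [folklore] -/
theorem k2r_ref_K0_sq_mul_exp_le {E : ℝ} (hE : 0 ≤ E) :
    (1 + E) ^ 2 * Real.exp (-E / 2) ≤ 32 * Real.exp (-E / 4) := by
  have h := k2r_ref_K0_sq_le_exp hE
  have hexp : Real.exp (E / 4) * Real.exp (-E / 2) = Real.exp (-E / 4) := by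
    rw [← Real.exp_add]; congr 1; ring
  calc (1 + E) ^ 2 * Real.exp (-E / 2) ≤ 32 * Real.exp (E / 4) * Real.exp (-E / 2) := by gcongr
    _ = 32 * Real.exp (-E / 4) := by rw [mul_assoc, hexp]

/-! ## Primitives and improper integrals on `(x, ∞)` -/

/-- The derivative of `E ↦ -(1/2)(1+E)⁻² e^{-E/R}` is `ϑ_R(E) + (2R)⁻¹ (1+E)⁻² e^{-E/R}`. [folklore] -/
theorem k2r_ref_K0_hasDerivAt_primitive {R : ℝ} {E : ℝ} (hE : -1 < E) :
    HasDerivAt (fun E => -(1 / 2) * ((1 + E) ^ 2)⁻¹ * Real.exp (-E / R))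
      (((1 + E) ^ 3)⁻¹ * Real.exp (-E / R) + (2 * R)⁻¹ * (((1 + E) ^ 2)⁻¹ * Real.exp (-E / R))) E := by
  have hne' : (1 + E) ≠ 0 := by linarith
  have hne : (1 + E) ^ 2 ≠ 0 := pow_ne_zero 2 hne'
  have h2 := (((hasDerivAt_id' E).const_add 1).fun_pow 2).fun_inv hne
  have h3 : HasDerivAt (fun E : ℝ => Real.exp (-E / R)) (Real.exp (-E / R) * (-1 / R)) E :=
    ((hasDerivAt_id' E).fun_neg.div_const R).exp
  refine ((h2.const_mul (-(1 / 2) : ℝ)).fun_mul h3).congr_deriv ?_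
  rcases eq_or_ne R 0 with hR | hR
  · subst hR; field_simp; ring
  · field_simp; ring

/-- `-(1/2)(1+E)⁻² e^{-E/R} → 0` as `E → ∞` (`R > 0`). [folklore] -/
theorem k2r_ref_K0_tendsto_primitive {R : ℝ} (hR : 0 < R) :
    Tendsto (fun E : ℝ => -(1 / 2) * ((1 + E) ^ 2)⁻¹ * Real.exp (-E / R)) atTop (𝓝 0) := by
  have h1 : Tendsto (fun E : ℝ => ((1 + E) ^ 2)⁻¹) atTop (𝓝 0) :=
    tendsto_inv_atTop_zero.comp
      ((tendsto_pow_atTop two_ne_zero).comp (tendsto_atTop_add_const_left _ 1 tendsto_id))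
  have h2 : Tendsto (fun E : ℝ => Real.exp (-E / R)) atTop (𝓝 0) := by
    refine Real.tendsto_exp_atBot.comp ?_
    have : Tendsto (fun E : ℝ => -E) atTop atBot := tendsto_neg_atTop_atBot
    simpa [neg_div] using this.atBot_div_const hR
  simpa using (h1.const_mul (-(1 / 2) : ℝ)).mul h2

/-- FTC on `(x, ∞)`, `x > -1`: `ϑ_R + (2R)⁻¹ ψ_R` is integrable there with integral
`½ (1+x)⁻² e^{-x/R}`. [folklore] -/
theorem k2r_ref_K0_integral_th_add_psi {R : ℝ} (hR : 0 < R) {x : ℝ} (hx : -1 < x) :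
    IntegrableOn (fun E => ((1 + E) ^ 3)⁻¹ * Real.exp (-E / R)
        + (2 * R)⁻¹ * (((1 + E) ^ 2)⁻¹ * Real.exp (-E / R))) (Ioi x) ∧
      ∫ E in Ioi x, (((1 + E) ^ 3)⁻¹ * Real.exp (-E / R)
        + (2 * R)⁻¹ * (((1 + E) ^ 2)⁻¹ * Real.exp (-E / R)))
        = (1 / 2) * ((1 + x) ^ 2)⁻¹ * Real.exp (-x / R) := by
  have hderiv : ∀ E ∈ Ici x, HasDerivAt (fun E => -(1 / 2) * ((1 + E) ^ 2)⁻¹ * Real.exp (-E / R))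
      (((1 + E) ^ 3)⁻¹ * Real.exp (-E / R) + (2 * R)⁻¹ * (((1 + E) ^ 2)⁻¹ * Real.exp (-E / R))) E :=
    fun E hE => k2r_ref_K0_hasDerivAt_primitive (lt_of_lt_of_le hx hE)
  have hpos : ∀ E ∈ Ioi x, 0 ≤ ((1 + E) ^ 3)⁻¹ * Real.exp (-E / R)
      + (2 * R)⁻¹ * (((1 + E) ^ 2)⁻¹ * Real.exp (-E / R)) := by
    intro E hE
    have : 0 < 1 + E := by simp only [mem_Ioi] at hE; linarith
    positivity
  refine ⟨integrableOn_Ioi_deriv_of_nonneg' hderiv hpos (k2r_ref_K0_tendsto_primitive hR), ?_⟩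
  rw [integral_Ioi_of_hasDerivAt_of_nonneg' hderiv hpos (k2r_ref_K0_tendsto_primitive hR)]
  ring

/-- Scaled tail `∫_x^∞ c (1+E)⁻² dE = c (1+x)⁻¹` for `x > -1`, with integrability (the case `c = 1`
is `k2r_ref_K2_integral_p2` of the sibling stub `kernelDeloc`). [folklore] -/
theorem k2r_ref_K0_integral_const_mul_inv_sq (c : ℝ) {x : ℝ} (hx : -1 < x) :
    IntegrableOn (fun E : ℝ => c * ((1 + E) ^ 2)⁻¹) (Ioi x) ∧
      ∫ E in Ioi x, c * ((1 + E) ^ 2)⁻¹ = c * (1 + x)⁻¹ := by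
  have hderiv : ∀ E ∈ Ici x, HasDerivAt (fun E : ℝ => -(1 + E)⁻¹) (((1 + E) ^ 2)⁻¹) E := by
    intro E hE
    have hne' : (1 + E) ≠ 0 := by have := mem_Ici.1 hE; linarith
    refine (((hasDerivAt_id' E).const_add 1).fun_inv hne').fun_neg.congr_deriv ?_
    field_simp
  have hpos : ∀ E ∈ Ioi x, (0:ℝ) ≤ ((1 + E) ^ 2)⁻¹ := fun E _ => by positivity
  have hlim : Tendsto (fun E : ℝ => -(1 + E)⁻¹) atTop (𝓝 0) := by
    simpa using (tendsto_inv_atTop_zero.comp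
      (tendsto_atTop_add_const_left (atTop : Filter ℝ) (1:ℝ) tendsto_id)).neg
  have hint := integrableOn_Ioi_deriv_of_nonneg' hderiv hpos hlim
  refine ⟨hint.const_mul c, ?_⟩
  rw [integral_const_mul, integral_Ioi_of_hasDerivAt_of_nonneg' hderiv hpos hlim]
  ring

/-- `ψ_R(E) ≤ e^{-x/R} (1+E)⁻²` for `E ≥ x` (`R > 0`). [folklore] -/
theorem k2r_ref_K0_psi_le {R : ℝ} (hR : 0 < R) {x E : ℝ} (hxE : x ≤ E) :
    ((1 + E) ^ 2)⁻¹ * Real.exp (-E / R) ≤ Real.exp (-x / R) * ((1 + E) ^ 2)⁻¹ := by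
  rw [mul_comm]
  have : Real.exp (-E / R) ≤ Real.exp (-x / R) :=
    Real.exp_le_exp.mpr (div_le_div_of_nonneg_right (neg_le_neg hxE) hR.le)
  gcongr

/-- `ψ_R` is integrable on `(x, ∞)` for `x > -1` (`R > 0`). [folklore] -/
theorem k2r_ref_K0_psi_integrableOn {R : ℝ} (hR : 0 < R) {x : ℝ} (hx : -1 < x) :
    IntegrableOn (fun E : ℝ => ((1 + E) ^ 2)⁻¹ * Real.exp (-E / R)) (Ioi x) := by
  have hcont : ContinuousOn (fun E : ℝ => ((1 + E) ^ 2)⁻¹ * Real.exp (-E / R)) (Ioi x) := by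
    refine ContinuousOn.mul (ContinuousOn.inv₀ (by fun_prop) ?_) (by fun_prop)
    intro y hy; simp only [mem_Ioi] at hy; exact pow_ne_zero _ (by linarith)
  refine (k2r_ref_K0_integral_const_mul_inv_sq (Real.exp (-x / R)) hx).1.mono'
    (hcont.aestronglyMeasurable measurableSet_Ioi) ?_
  refine (ae_restrict_iff' measurableSet_Ioi).mpr (ae_of_all _ fun E hE => ?_)
  rw [Real.norm_eq_abs, abs_of_nonneg (by positivity)]
  exact k2r_ref_K0_psi_le hR (le_of_lt hE)

/-- Tail bounds `0 ≤ ∫_x^∞ ψ_R` and `(1+x) ∫_x^∞ ψ_R ≤ e^{-x/R}` for `x > -1` (`R > 0`). [folklore] -/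
theorem k2r_ref_K0_T_bounds {R : ℝ} (hR : 0 < R) {x : ℝ} (hx : -1 < x) :
    0 ≤ ∫ E in Ioi x, ((1 + E) ^ 2)⁻¹ * Real.exp (-E / R) ∧
      (1 + x) * ∫ E in Ioi x, ((1 + E) ^ 2)⁻¹ * Real.exp (-E / R) ≤ Real.exp (-x / R) := by
  constructor
  · exact setIntegral_nonneg measurableSet_Ioi fun E _ => by positivity
  · have h1 := k2r_ref_K0_integral_const_mul_inv_sq (Real.exp (-x / R)) hx
    have hle : ∫ E in Ioi x, ((1 + E) ^ 2)⁻¹ * Real.exp (-E / R)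
        ≤ ∫ E in Ioi x, Real.exp (-x / R) * ((1 + E) ^ 2)⁻¹ :=
      setIntegral_mono_on (k2r_ref_K0_psi_integrableOn hR hx) h1.1
        measurableSet_Ioi (fun E hE => k2r_ref_K0_psi_le hR (le_of_lt hE))
    rw [h1.2] at hle
    have hx1 : 0 < 1 + x := by linarith
    calc (1 + x) * ∫ E in Ioi x, ((1 + E) ^ 2)⁻¹ * Real.exp (-E / R)
        ≤ (1 + x) * (Real.exp (-x / R) * (1 + x)⁻¹) := by gcongr
      _ = Real.exp (-x / R) := by field_simp

/-! ## The weight `ϑ_R` and its tail `Θ̄_R` -/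

section Theta

variable {R : ℝ} {ϑ Θ : ℝ → ℝ}

/-- `ϑ_R` is continuous on `(-1, ∞)`. [folklore] -/
theorem k2r_ref_K0_th_continuousOn (hϑ : ∀ E, ϑ E = ((1 + E) ^ 3)⁻¹ * Real.exp (-E / R)) :
    ContinuousOn ϑ (Ioi (-1)) := by
  rw [show ϑ = fun E => ((1 + E) ^ 3)⁻¹ * Real.exp (-E / R) from funext hϑ]
  refine ContinuousOn.mul (ContinuousOn.inv₀ (by fun_prop) ?_) (by fun_prop)
  intro x hx; simp only [mem_Ioi] at hx; exact pow_ne_zero _ (by linarith)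

/-- `ϑ_R ≥ 0` on `(-1, ∞)`. [folklore] -/
theorem k2r_ref_K0_th_nonneg (hϑ : ∀ E, ϑ E = ((1 + E) ^ 3)⁻¹ * Real.exp (-E / R)) {E : ℝ}
    (hE : -1 < E) : 0 ≤ ϑ E := by
  rw [hϑ]; have : 0 < 1 + E := by linarith
  positivity

/-- `ϑ_R(E) ≤ (1+E)⁻³` for `E ≥ 0` (`R > 0`). [folklore] -/
theorem k2r_ref_K0_th_le (hR : 0 < R) (hϑ : ∀ E, ϑ E = ((1 + E) ^ 3)⁻¹ * Real.exp (-E / R))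
    {E : ℝ} (hE : 0 ≤ E) : ϑ E ≤ ((1 + E) ^ 3)⁻¹ := by
  rw [hϑ]
  have hexp : Real.exp (-E / R) ≤ 1 :=
    Real.exp_le_one_iff.mpr (div_nonpos_of_nonpos_of_nonneg (by linarith) hR.le)
  have h0 : (0:ℝ) ≤ ((1 + E) ^ 3)⁻¹ := by positivity
  nlinarith

/-- `ϑ_R` is integrable on `(x, ∞)` for `x > -1` (`R > 0`). [folklore] -/
theorem k2r_ref_K0_th_integrableOn (hR : 0 < R)
    (hϑ : ∀ E, ϑ E = ((1 + E) ^ 3)⁻¹ * Real.exp (-E / R)) {x : ℝ} (hx : -1 < x) :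
    IntegrableOn ϑ (Ioi x) := by
  obtain ⟨hint, -⟩ := k2r_ref_K0_integral_th_add_psi hR hx
  refine hint.mono' (((k2r_ref_K0_th_continuousOn hϑ).mono (Ioi_subset_Ioi hx.le)).aestronglyMeasurable
    measurableSet_Ioi) ?_
  refine (ae_restrict_iff' measurableSet_Ioi).mpr (ae_of_all _ fun E hE => ?_)
  have hE' : -1 < E := lt_trans hx hE
  rw [Real.norm_eq_abs, abs_of_nonneg (k2r_ref_K0_th_nonneg hϑ hE'), hϑ]
  have : 0 < 1 + E := by linarith
  have : 0 ≤ (2 * R)⁻¹ * (((1 + E) ^ 2)⁻¹ * Real.exp (-E / R)) := by positivity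
  linarith

/-- Closed form of the tail: `Θ̄_R(x) = ½ (1+x)⁻² e^{-x/R} - (2R)⁻¹ ∫_x^∞ ψ_R` (`x > -1`). [folklore] -/
theorem k2r_ref_K0_Theta_eq (hR : 0 < R) (hϑ : ∀ E, ϑ E = ((1 + E) ^ 3)⁻¹ * Real.exp (-E / R))
    (hΘ : ∀ x, Θ x = ∫ E in Ioi x, ϑ E) {x : ℝ} (hx : -1 < x) :
    Θ x = (1 / 2) * ((1 + x) ^ 2)⁻¹ * Real.exp (-x / R)
      - (2 * R)⁻¹ * ∫ E in Ioi x, ((1 + E) ^ 2)⁻¹ * Real.exp (-E / R) := by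
  obtain ⟨-, hval⟩ := k2r_ref_K0_integral_th_add_psi hR hx
  have hϑ' : ϑ = fun E => ((1 + E) ^ 3)⁻¹ * Real.exp (-E / R) := funext hϑ
  have h1 : IntegrableOn (fun E => ((1 + E) ^ 3)⁻¹ * Real.exp (-E / R)) (Ioi x) :=
    hϑ' ▸ k2r_ref_K0_th_integrableOn hR hϑ hx
  rw [integral_add h1 ((k2r_ref_K0_psi_integrableOn hR hx).const_mul _), integral_const_mul] at hval
  rw [hΘ, hϑ']
  linarith

/-- `0 ≤ Θ̄_R(x) ≤ ½ (1+x)⁻²` for `x ≥ 0` (`R > 0`). [folklore] -/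
theorem k2r_ref_K0_Theta_bounds (hR : 0 < R) (hϑ : ∀ E, ϑ E = ((1 + E) ^ 3)⁻¹ * Real.exp (-E / R))
    (hΘ : ∀ x, Θ x = ∫ E in Ioi x, ϑ E) {x : ℝ} (hx : 0 ≤ x) :
    0 ≤ Θ x ∧ Θ x ≤ 1 / 2 * ((1 + x) ^ 2)⁻¹ := by
  constructor
  · rw [hΘ]
    exact setIntegral_nonneg measurableSet_Ioi fun E hE =>
      k2r_ref_K0_th_nonneg hϑ (by simp only [mem_Ioi] at hE; linarith)
  · rw [k2r_ref_K0_Theta_eq hR hϑ hΘ (by linarith)]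
    have hT := (k2r_ref_K0_T_bounds hR (by linarith : (-1:ℝ) < x)).1
    have hexp : Real.exp (-x / R) ≤ 1 :=
      Real.exp_le_one_iff.mpr (div_nonpos_of_nonpos_of_nonneg (by linarith) hR.le)
    have h0 : (0:ℝ) ≤ ((1 + x) ^ 2)⁻¹ := by positivity
    have h1 : (0:ℝ) ≤ (2 * R)⁻¹ := by positivity
    nlinarith [mul_nonneg h1 hT]

/-- **The critical identity.** `x ϑ_R(x) + ϑ_R(x) - 2 Θ̄_R(x) = R⁻¹ ∫_x^∞ ψ_R` lies in
`[0, R⁻¹ e^{-x/R} (1+x)⁻¹]` (`x ≥ 0`, `R > 0`): the gain `2Θ̄` cancels the loss `(1+x)ϑ` exactly at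
the power `3`, up to a term of total weighted mass `≤ 1/R · R = 1`. [folklore] -/
theorem k2r_ref_K0_Theta_critical (hR : 0 < R)
    (hϑ : ∀ E, ϑ E = ((1 + E) ^ 3)⁻¹ * Real.exp (-E / R))
    (hΘ : ∀ x, Θ x = ∫ E in Ioi x, ϑ E) {x : ℝ} (hx : 0 ≤ x) :
    0 ≤ x * ϑ x + ϑ x - 2 * Θ x ∧
      (1 + x) * (x * ϑ x + ϑ x - 2 * Θ x) ≤ R⁻¹ * Real.exp (-x / R) := by
  have hx' : (-1:ℝ) < x := by linarith
  have hTeq := k2r_ref_K0_Theta_eq hR hϑ hΘ hx'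
  obtain ⟨hT0, hT1⟩ := k2r_ref_K0_T_bounds hR hx'
  set T := ∫ E in Ioi x, ((1 + E) ^ 2)⁻¹ * Real.exp (-E / R) with hTdef
  have hx1 : (1 + x) ≠ 0 := by linarith
  have hkey : x * ϑ x + ϑ x - 2 * Θ x = R⁻¹ * T := by
    rw [hTeq, hϑ]; field_simp; ring
  rw [hkey]
  refine ⟨by positivity, ?_⟩
  calc (1 + x) * (R⁻¹ * T) = R⁻¹ * ((1 + x) * T) := by ring
    _ ≤ R⁻¹ * Real.exp (-x / R) := by gcongr

/-- `Θ̄_R` is differentiable on `(-1, ∞)` with `Θ̄_R' = -ϑ_R` (`R > 0`). [folklore] -/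
theorem k2r_ref_K0_Theta_hasDerivAt (hR : 0 < R)
    (hϑ : ∀ E, ϑ E = ((1 + E) ^ 3)⁻¹ * Real.exp (-E / R))
    (hΘ : ∀ x, Θ x = ∫ E in Ioi x, ϑ E) {x : ℝ} (hx : -1 < x) :
    HasDerivAt Θ (-ϑ x) x := by
  have hcont := k2r_ref_K0_th_continuousOn hϑ
  have hrepr : ∀ y, -1 < y → Θ y = Θ 0 - ∫ t in (0:ℝ)..y, ϑ t := by
    intro y hy
    have := intervalIntegral.integral_Ioi_sub_Ioi'
      (k2r_ref_K0_th_integrableOn hR hϑ (by norm_num : (-1:ℝ) < 0))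
      (k2r_ref_K0_th_integrableOn hR hϑ hy)
    rw [hΘ, hΘ]; linarith
  have hsub : uIcc 0 x ⊆ Ioi (-1) := by
    intro t ht
    rw [mem_uIcc] at ht
    simp only [mem_Ioi]
    rcases ht with ⟨h1, -⟩ | ⟨h1, -⟩ <;> linarith
  have hII : IntervalIntegrable ϑ volume 0 x := (hcont.mono hsub).intervalIntegrable
  have hderiv : HasDerivAt (fun y => Θ 0 - ∫ t in (0:ℝ)..y, ϑ t) (-ϑ x) x :=
    (intervalIntegral.integral_hasDerivAt_right hII
      (hcont.stronglyMeasurableAtFilter isOpen_Ioi x hx)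
      (hcont.continuousAt (Ioi_mem_nhds hx))).const_sub (Θ 0)
  refine hderiv.congr_of_eventuallyEq ?_
  filter_upwards [Ioi_mem_nhds hx] with y hy using hrepr y hy

/-- `Θ̄_R` is continuous on `(-1, ∞)` (`R > 0`). [folklore] -/
theorem k2r_ref_K0_Theta_continuousOn (hR : 0 < R)
    (hϑ : ∀ E, ϑ E = ((1 + E) ^ 3)⁻¹ * Real.exp (-E / R))
    (hΘ : ∀ x, Θ x = ∫ E in Ioi x, ϑ E) : ContinuousOn Θ (Ioi (-1)) :=
  fun _ hx => (k2r_ref_K0_Theta_hasDerivAt hR hϑ hΘ hx).continuousAt.continuousWithinAt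

end Theta


/-! ## The sphere-reduced gain integral at fixed energy -/

section Gain

variable {R : ℝ} {ϑ Θ : ℝ → ℝ}

/-- `t ↦ ϑ_R(E t²)` and `t ↦ Θ̄_R(E t²)` are continuous for `E ≥ 0`. [folklore] -/
theorem k2r_ref_K0_comp_sq_continuous (hR : 0 < R)
    (hϑ : ∀ E, ϑ E = ((1 + E) ^ 3)⁻¹ * Real.exp (-E / R))
    (hΘ : ∀ x, Θ x = ∫ E in Ioi x, ϑ E) {E : ℝ} (hE : 0 ≤ E) :
    Continuous (fun t : ℝ => ϑ (E * t ^ 2)) ∧ Continuous (fun t : ℝ => Θ (E * t ^ 2)) := by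
  have hmem : ∀ t : ℝ, E * t ^ 2 ∈ Ioi (-1) := fun t => by
    simp only [mem_Ioi]; nlinarith [sq_nonneg t]
  exact ⟨(k2r_ref_K0_th_continuousOn hϑ).comp_continuous (by fun_prop) hmem,
    (k2r_ref_K0_Theta_continuousOn hR hϑ hΘ).comp_continuous (by fun_prop) hmem⟩

/-- The Gaussian-tail part of the gain: with `0 ≤ r(a) = h(a) - a₊ ≤ e^{-a²/2}`,
`0 ≤ ∫_{-1}^{1} e^{-E(1-t²)/2} r(√E t) Θ̄_R(E t²) dt ≤ e^{-E/2}`. [folklore] -/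
theorem k2r_ref_K0_rpart (hR : 0 < R)
    (hϑ : ∀ E, ϑ E = ((1 + E) ^ 3)⁻¹ * Real.exp (-E / R))
    (hΘ : ∀ x, Θ x = ∫ E in Ioi x, ϑ E) {h : ℝ → ℝ} (hh : Continuous h)
    (hb : ∀ a, 0 ≤ h a - max a 0 ∧ h a - max a 0 ≤ Real.exp (-a ^ 2 / 2)) {E : ℝ} (hE : 0 ≤ E) :
    0 ≤ ∫ t in (-1:ℝ)..1, Real.exp (-(E * (1 - t ^ 2)) / 2)
        * (h (Real.sqrt E * t) - max (Real.sqrt E * t) 0) * Θ (E * t ^ 2) ∧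
      ∫ t in (-1:ℝ)..1, Real.exp (-(E * (1 - t ^ 2)) / 2)
        * (h (Real.sqrt E * t) - max (Real.sqrt E * t) 0) * Θ (E * t ^ 2) ≤ Real.exp (-E / 2) := by
  obtain ⟨-, hΘc⟩ := k2r_ref_K0_comp_sq_continuous hR hϑ hΘ hE
  have hpt : ∀ t ∈ Icc (-1:ℝ) 1,
      0 ≤ Real.exp (-(E * (1 - t ^ 2)) / 2) * (h (Real.sqrt E * t) - max (Real.sqrt E * t) 0)
          * Θ (E * t ^ 2) ∧
        Real.exp (-(E * (1 - t ^ 2)) / 2) * (h (Real.sqrt E * t) - max (Real.sqrt E * t) 0)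
          * Θ (E * t ^ 2) ≤ Real.exp (-E / 2) / 2 := by
    intro t _
    obtain ⟨hr0, hr1⟩ := hb (Real.sqrt E * t)
    obtain ⟨hΘ0, hΘ1⟩ := k2r_ref_K0_Theta_bounds hR hϑ hΘ (show 0 ≤ E * t ^ 2 by positivity)
    have hΘhalf : Θ (E * t ^ 2) ≤ 1 / 2 := by
      refine hΘ1.trans ?_
      have : ((1 + E * t ^ 2) ^ 2)⁻¹ ≤ (1:ℝ) :=
        inv_le_one_of_one_le₀ (by nlinarith [sq_nonneg t, mul_nonneg hE (sq_nonneg t)])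
      linarith
    have hexp : Real.exp (-(E * (1 - t ^ 2)) / 2) * Real.exp (-(Real.sqrt E * t) ^ 2 / 2)
        = Real.exp (-E / 2) := by
      rw [← Real.exp_add, mul_pow, Real.sq_sqrt hE]; congr 1; ring
    refine ⟨mul_nonneg (mul_nonneg (Real.exp_nonneg _) hr0) hΘ0, ?_⟩
    calc Real.exp (-(E * (1 - t ^ 2)) / 2) * (h (Real.sqrt E * t) - max (Real.sqrt E * t) 0)
          * Θ (E * t ^ 2)
        ≤ Real.exp (-(E * (1 - t ^ 2)) / 2) * Real.exp (-(Real.sqrt E * t) ^ 2 / 2) * (1 / 2) := by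
          gcongr
      _ = Real.exp (-E / 2) / 2 := by rw [hexp]; ring
  have hII : IntervalIntegrable (fun t => Real.exp (-(E * (1 - t ^ 2)) / 2)
      * (h (Real.sqrt E * t) - max (Real.sqrt E * t) 0) * Θ (E * t ^ 2)) volume (-1) 1 :=
    (Continuous.mul (by fun_prop) hΘc).intervalIntegrable _ _
  refine ⟨intervalIntegral.integral_nonneg (by norm_num) fun t ht => (hpt t ht).1, ?_⟩
  calc ∫ t in (-1:ℝ)..1, Real.exp (-(E * (1 - t ^ 2)) / 2)
        * (h (Real.sqrt E * t) - max (Real.sqrt E * t) 0) * Θ (E * t ^ 2)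
      ≤ ∫ _ in (-1:ℝ)..1, Real.exp (-E / 2) / 2 :=
        intervalIntegral.integral_mono_on (by norm_num) hII (by simp) fun t ht => (hpt t ht).2
    _ = Real.exp (-E / 2) := by rw [intervalIntegral.integral_const]; simp; ring

/-- The positive-part part of the gain lives on `t ∈ [0,1]`:
`∫_{-1}^{1} e^{-E(1-t²)/2} (√E t)₊ Θ̄(E t²) dt = √E ∫_0^1 Θ̄(E t²) t e^{-E(1-t²)/2} dt`. [folklore] -/
theorem k2r_ref_K0_mainpart_split {E : ℝ} (hΘc : Continuous fun t : ℝ => Θ (E * t ^ 2)) :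
    ∫ t in (-1:ℝ)..1, Real.exp (-(E * (1 - t ^ 2)) / 2) * max (Real.sqrt E * t) 0 * Θ (E * t ^ 2)
      = Real.sqrt E * ∫ t in (0:ℝ)..1, Θ (E * t ^ 2) * (t * Real.exp (-(E * (1 - t ^ 2)) / 2)) := by
  have hFc : Continuous fun t => Real.exp (-(E * (1 - t ^ 2)) / 2) * max (Real.sqrt E * t) 0
      * Θ (E * t ^ 2) := Continuous.mul (by fun_prop) hΘc
  rw [← intervalIntegral.integral_add_adjacent_intervals (hFc.intervalIntegrable (-1) 0)
    (hFc.intervalIntegrable 0 1)]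
  have h1 : ∫ t in (-1:ℝ)..0, Real.exp (-(E * (1 - t ^ 2)) / 2) * max (Real.sqrt E * t) 0
      * Θ (E * t ^ 2) = ∫ _ in (-1:ℝ)..0, (0:ℝ) := by
    refine intervalIntegral.integral_congr fun t ht => ?_
    rw [uIcc_of_le (by norm_num)] at ht
    rw [max_eq_right (mul_nonpos_of_nonneg_of_nonpos (Real.sqrt_nonneg E) ht.2)]; ring
  have h2 : ∫ t in (0:ℝ)..1, Real.exp (-(E * (1 - t ^ 2)) / 2) * max (Real.sqrt E * t) 0
      * Θ (E * t ^ 2) = ∫ t in (0:ℝ)..1, Real.sqrt E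
        * (Θ (E * t ^ 2) * (t * Real.exp (-(E * (1 - t ^ 2)) / 2))) := by
    refine intervalIntegral.integral_congr fun t ht => ?_
    rw [uIcc_of_le zero_le_one] at ht
    rw [max_eq_left (mul_nonneg (Real.sqrt_nonneg E) ht.1)]; ring
  rw [h1, h2, intervalIntegral.integral_const_mul, intervalIntegral.integral_zero, zero_add]

/-- Keyed statement of this preparatory file (sub-goal `stub_kernelCritical_prep` of the line):
the critical identity bound `(1+x)(x ϑ_R(x) + ϑ_R(x) - 2Θ̄_R(x)) ≤ R⁻¹ e^{-x/R}` for the weight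
`ϑ_R(x) = (1+x)⁻³ e^{-x/R}`, `x ≥ 0`, `R > 0`. -/
theorem stub_kernelCritical_prep : ∀ R : ℝ, 0 < R → ∀ x : ℝ, 0 ≤ x →
    (1 + x) * (x * (((1 + x) ^ 3)⁻¹ * Real.exp (-x / R)) + ((1 + x) ^ 3)⁻¹ * Real.exp (-x / R)
      - 2 * ∫ E in Set.Ioi x, ((1 + E) ^ 3)⁻¹ * Real.exp (-E / R)) ≤ R⁻¹ * Real.exp (-x / R) :=
  fun _ hR _ hx => (k2r_ref_K0_Theta_critical hR (fun _ => rfl) (fun _ => rfl) hx).2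

end Gain

end Summit.AtomisticToContinuum.HydrodynamicLimit.Theorems.EnskogAdjointDuality
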